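import Summits.QuantumFields.YangMills.Theorems.FluctuationComparisonRegPrIntLWregChartEdgeEngine
import Summits.QuantumFields.YangMills.Theorems.BalabanUVNodesN09CentralWindowOpenMapping
import Summits.QuantumFields.YangMills.Theorems.BalabanUVNodesN09CentralWindowAtRecord
import HarnessLib

/-!
# LINE g18-2 «wreg_chart» (20520 organ WREG) — EDGE engine, part 2: the one-variable CHAIN of the iterated (0.4) averaging, characterised by its
# recursion equations — recursion, measurability, injectivity, continuity, closed image windows with Haar-null frontier

Cell `ym3-torus`, width seat `ym3-torus-px17` g6 (helper of `stmt-QuantumFields-20520`, `--supports`, count-neutral).  The ideator's Cruxes-local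
objects `iterCentralBond` ∕ `chainMap` ∕ `chainWindow` (`Cruxes/FluctuationComparisonRegPrIntL/Lines/wreg_chart.lean` §0–§0b) are not importable under
`Theorems/`; here they enter as ARBITRARY families `icb` ∕ `cm` ∕ `cw` satisfying the defining recursion equations (`hicb0`, `hicbS`, `hcm`, `hcw0`,
`hcwS` — each an `rfl` ∕ `Iff.rfl` for the ideator's definitions), so that every theorem below instantiates to the line's objects by `rfl`s.

CONTENT (generic torus `P`, `G = SU(N)`; the (0.4) average `expMeanLogSU`):  §1 triangularity of the iterated averaging in the iterated central bond
(`iter_update_icb_apply_of_ne`) and the chain recursion `cm (n+1) U c = Ū′_{Ū⁽ⁿ⁾U, c} ∘ cm n U (β c)` (`cm_succ_apply`); §2 joint measurability of the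
chain and of the iterated window as a subset of `(environment, pivot)`; §3 injectivity of the chain on its window (N09's one-step injectivity, composed);
§4 continuity of the chain on the (closed) window, closedness of the image window; §5 ★★ the image window `T⁽ⁿ⁾ = cm n U c '' cw n U c` has
HAAR-NULL FRONTIER for EVERY environment: `T⁽ⁿ⁺¹⁾ = f '' (T⁽ⁿ⁾ ∩ Ω)`, `T⁽ⁿ⁺¹⁾ ∖ int ⊆ f '' ((T⁽ⁿ⁾ ∖ int) ∩ Ω) ∪ f '' (Ω ∩ edge Ω)` (N09's open mapping at
window points), both pieces Haar-null by part 1's PUSH and the Haar-nullity of the edge set.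

HONEST FRAMING.  Bookkeeping over landed N09 calculus; nothing of Bałaban's is asserted; EDGE itself is assembled in part 4; WREG, S2β,
`FluctuationComparisonRegPrIntL` (20520) and every other crux are NOT proved; rung R3 = YM₃ on T³ — NOT d = 4, NOT infinite volume, NOT a mass gap, NOT Clay.
-/

noncomputable section

open MeasureTheory Set Function Filter Topology
open scoped ENNReal NNReal
open Literature.MathematicalPhysics.QuantumFieldTheory.Balaban1983to89
open Literature.MathematicalPhysics.QuantumFieldTheory.Balaban1983to89.Node00 (SU)
open Literature.MathematicalPhysics.QuantumFieldTheory.Balaban1983to89.ExpMeanLog (expMeanLogSU deltaSU)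
open Literature.MathematicalPhysics.QuantumFieldTheory.Balaban1983to89.BlockAveraging (Idx avgFun)
open Literature.MathematicalPhysics.QuantumFieldTheory.Balaban1983to89.BlockAveragingHaarAC (centralBond pre post openHol IsCentral isLocal_avgFun)
open Literature.MathematicalPhysics.QuantumFieldTheory.Balaban1983to89.BlockAveragingEMLHaarAC (fibreFamily offCard
  fibreFamily_of_isCentral fibreFamily_of_not_isCentral)
open Summit.QuantumFields.YangMills.BalabanUVNodes.N09CentralWindowAtRecord (avgFun_update_centralBond_injOn_centralWindow)
open Summit.QuantumFields.YangMills.BalabanUVNodes.N09CentralWindowOpenMapping (map_nhds_oneVariable_eq_of_mem_centralWindow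
  isOpen_strictCentralWindowSet)
open Summit.QuantumFields.YangMills.BalabanUVNodes.N09CentralWindowForwardLaw (isClosed_centralWindowW)
open Summit.QuantumFields.YangMills.Theorems.FluctuationComparisonRegPrIntLWregChartEdgeEngine (haar_edgeSet_eq_zero
  haar_image_eq_zero_of_subset_window continuous_coord measurableSet_edgeSet measurable_coord_prod)

namespace Summit.QuantumFields.YangMills.Theorems.FluctuationComparisonRegPrIntLWregChartChainLetters

/-! ## §1  Triangularity and the chain recursion (every group, every small-loop average) -/

section Generic

variable {P : Params} {G : Type*} [GaugeGroup G]

/-- ★ **THE `n`-FOLD BLOCK AVERAGING IS TRIANGULAR IN THE ITERATED CENTRAL BOND**: moving the fine bond `βₙ c` moves `Ū⁽ⁿ⁾` only at `c` (one-step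
locality `isLocal_avgFun`, by induction; the iterated central bond `icb` enters through its recursion `β₀ = id`, `βₙ₊₁ = βₙ ∘ centralBond`).
[cite: Balaban1987RG1, (0.4) p.253] -/
theorem iter_update_icb_apply_of_ne (ℰ : LoopAverage G) (icb : (n : ℕ) → PBond P n → PBond P 0)
    (hicb0 : ∀ c, icb 0 c = c) (hicbS : ∀ n (c : PBond P (n + 1)), icb (n + 1) c = icb n (centralBond c)) :
    ∀ {n : ℕ}, n ≤ P.m + P.K → ∀ (U : GaugeField P 0 G) (c : PBond P n) (g : G) (c' : PBond P n), c' ≠ c →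
      Averaging.iter (fun i => BlockAveraging.blockAvg (P := P) (j := i) ℰ) n (update U (icb n c) g) c' =
        Averaging.iter (fun i => BlockAveraging.blockAvg (P := P) (j := i) ℰ) n U c'
  | 0, _ => by
      intro U c g c' hc
      simp [Averaging.iter, hicb0, update_of_ne hc]
  | n + 1, hn => by
      intro U c g c' hc
      have IH := iter_update_icb_apply_of_ne ℰ icb hicb0 hicbS (n := n) (by omega)
      set W := Averaging.iter (fun i => BlockAveraging.blockAvg (P := P) (j := i) ℰ) n (update U (icb (n + 1) c) g) with hW
      set W₀ := Averaging.iter (fun i => BlockAveraging.blockAvg (P := P) (j := i) ℰ) n U with hW₀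
      have hWeq : W = update W₀ (centralBond c) (W (centralBond c)) := by
        funext b
        by_cases hb : b = centralBond c
        · subst hb; simp
        · rw [update_of_ne hb, hW, hicbS]
          exact IH U (centralBond c) g b hb
      show BlockAveraging.avgFun ℰ W c' = BlockAveraging.avgFun ℰ W₀ c'
      rw [hWeq]
      exact isLocal_avgFun (by omega) ℰ W₀ c (W (centralBond c)) c' hc

/-- The chain at depth `0` is the identity (`Ū⁽⁰⁾ = id`, `β₀ = id`). [folklore] -/
theorem cm_zero_apply (ℰ : LoopAverage G) (icb : (n : ℕ) → PBond P n → PBond P 0) (hicb0 : ∀ c, icb 0 c = c)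
    (cm : (n : ℕ) → GaugeField P 0 G → PBond P n → G → G)
    (hcm : ∀ n U c g, cm n U c g = Averaging.iter (fun i => BlockAveraging.blockAvg (P := P) (j := i) ℰ) n (update U (icb n c) g) c)
    (U : GaugeField P 0 G) (c : PBond P 0) (g : G) : cm 0 U c g = g := by
  rw [hcm, hicb0]
  simp [Averaging.iter]

/-- ★ **CHAIN RECURSION**: `cm (n+1) U c g = Ū′_{Ū⁽ⁿ⁾U, c}(cm n U (β c) g)` — the depth-`(n+1)` chain is the one-level one-variable (0.4) map at the
environment `Ū⁽ⁿ⁾(U)` and coarse bond `c`, evaluated at the depth-`n` chain value at `centralBond c` (triangularity). [cite: Balaban1987RG1, (0.4) p.253] -/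
theorem cm_succ_apply (ℰ : LoopAverage G) (icb : (n : ℕ) → PBond P n → PBond P 0)
    (hicb0 : ∀ c, icb 0 c = c) (hicbS : ∀ n (c : PBond P (n + 1)), icb (n + 1) c = icb n (centralBond c))
    (cm : (n : ℕ) → GaugeField P 0 G → PBond P n → G → G)
    (hcm : ∀ n U c g, cm n U c g = Averaging.iter (fun i => BlockAveraging.blockAvg (P := P) (j := i) ℰ) n (update U (icb n c) g) c)
    {n : ℕ} (hn : n + 1 ≤ P.m + P.K) (U : GaugeField P 0 G) (c : PBond P (n + 1)) (g : G) :
    cm (n + 1) U c g = avgFun ℰ (update (Averaging.iter (fun i => BlockAveraging.blockAvg (P := P) (j := i) ℰ) n U) (centralBond c)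
      (cm n U (centralBond c) g)) c := by
  have IH := iter_update_icb_apply_of_ne ℰ icb hicb0 hicbS (n := n) (by omega)
  set W := Averaging.iter (fun i => BlockAveraging.blockAvg (P := P) (j := i) ℰ) n (update U (icb (n + 1) c) g) with hW
  set W₀ := Averaging.iter (fun i => BlockAveraging.blockAvg (P := P) (j := i) ℰ) n U with hW₀
  have hWeq : W = update W₀ (centralBond c) (W (centralBond c)) := by
    funext b
    by_cases hb : b = centralBond c
    · subst hb; simp
    · rw [update_of_ne hb, hW, hicbS]
      exact IH U (centralBond c) g b hb
  have hchain : cm n U (centralBond c) g = W (centralBond c) := by rw [hcm, hW, hicbS]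
  rw [hchain, hcm]
  show BlockAveraging.avgFun ℰ W c = BlockAveraging.avgFun ℰ (update W₀ (centralBond c) (W (centralBond c))) c
  rw [← hWeq]

end Generic

/-! ## §2–§5  The chain of the (0.4) average `expMeanLogSU` on `SU(N)`: measurability, injectivity, continuity, image windows -/

section Chain

variable {P : Params} {N : ℕ} [NeZero N]

variable (icb : (n : ℕ) → PBond P n → PBond P 0)
  (cm : (n : ℕ) → GaugeField P 0 (SU N) → PBond P n → SU N → SU N)
  (cw : (n : ℕ) → GaugeField P 0 (SU N) → PBond P n → Set (SU N))

/-- ★ **THE CHAIN IS JOINTLY MEASURABLE in `(environment, pivot value)`** (iterated measurable averaging of a measurable update). [cite: Balaban1987RG1, (0.4) p.253 (bookkeeping)] -/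
theorem measurable_cm_prod
    (hcm : ∀ n U c g, cm n U c g =
      Averaging.iter (fun i => BlockAveraging.blockAvg (P := P) (j := i) (expMeanLogSU (n := Fin N))) n (update U (icb n c) g) c)
    (n : ℕ) (c : PBond P n) :
    Measurable fun p : GaugeField P 0 (SU N) × SU N => cm n p.1 c p.2 := by
  have hfun : (fun p : GaugeField P 0 (SU N) × SU N => cm n p.1 c p.2) = fun p =>
      Averaging.iter (fun i => BlockAveraging.blockAvg (P := P) (j := i) (expMeanLogSU (n := Fin N))) n (update p.1 (icb n c) p.2) c :=
    funext fun p => hcm n p.1 c p.2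
  rw [hfun]
  have hiter := T4Continuum.measurable_iter (fun i => BlockAveraging.blockAvg (P := P) (j := i) (expMeanLogSU (n := Fin N)))
    (fun j => by rw [BlockAveraging.blockAvg_avg]; exact BlockAveraging.measurable_avgFun _ ExpMeanLog.measurable_expMeanLogSU_E) n
  exact (measurable_pi_apply c).comp (hiter.comp ((measurable_update' (a := icb n c)).comp (measurable_fst.prodMk measurable_snd)))

/-- The chain at a fixed environment is measurable in the pivot value. [folklore] -/
theorem measurable_cm
    (hcm : ∀ n U c g, cm n U c g =
      Averaging.iter (fun i => BlockAveraging.blockAvg (P := P) (j := i) (expMeanLogSU (n := Fin N))) n (update U (icb n c) g) c)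
    (n : ℕ) (U : GaugeField P 0 (SU N)) (c : PBond P n) : Measurable (cm n U c) :=
  (measurable_cm_prod icb cm hcm n c).comp (measurable_const.prodMk measurable_id)

/-- ★ **THE ITERATED WINDOW IS A JOINTLY MEASURABLE SUBSET of `(environment, pivot value)`** (recursion `hcw0`∕`hcwS`, measurable coordinates and chain).
[cite: Balaban1987RG1, (0.4) p.253 and (2.9) p.266 (bookkeeping)] -/
theorem measurableSet_cw_prod {α : ℝ}
    (hcm : ∀ n U c g, cm n U c g =
      Averaging.iter (fun i => BlockAveraging.blockAvg (P := P) (j := i) (expMeanLogSU (n := Fin N))) n (update U (icb n c) g) c)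
    (hcw0 : ∀ U c, cw 0 U c = univ)
    (hcwS : ∀ n U (c : PBond P (n + 1)), cw (n + 1) U c = {g | g ∈ cw n U (centralBond c) ∧
      cm n U (centralBond c) g ∈ {h : SU N | ∀ i : Idx P,
        dist1 (fibreFamily (Averaging.iter (fun i => BlockAveraging.blockAvg (P := P) (j := i) (expMeanLogSU (n := Fin N))) n U) c
          (pre (Averaging.iter (fun i => BlockAveraging.blockAvg (P := P) (j := i) (expMeanLogSU (n := Fin N))) n U) c * h *
            post (Averaging.iter (fun i => BlockAveraging.blockAvg (P := P) (j := i) (expMeanLogSU (n := Fin N))) n U) c) i) ≤ α}}) :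
    ∀ (n : ℕ) (c : PBond P n), MeasurableSet {p : GaugeField P 0 (SU N) × SU N | p.2 ∈ cw n p.1 c} := by
  intro n
  induction n with
  | zero =>
      intro c
      have hset : {p : GaugeField P 0 (SU N) × SU N | p.2 ∈ cw 0 p.1 c} = univ := by
        ext p; simp only [hcw0, mem_univ, mem_setOf_eq]
      rw [hset]; exact MeasurableSet.univ
  | succ n IH =>
      intro c
      have hiter := T4Continuum.measurable_iter (fun i => BlockAveraging.blockAvg (P := P) (j := i) (expMeanLogSU (n := Fin N)))
        (fun j => by rw [BlockAveraging.blockAvg_avg]; exact BlockAveraging.measurable_avgFun _ ExpMeanLog.measurable_expMeanLogSU_E) n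
      have hpair : Measurable fun p : GaugeField P 0 (SU N) × SU N =>
          ((Averaging.iter (fun i => BlockAveraging.blockAvg (P := P) (j := i) (expMeanLogSU (n := Fin N))) n p.1,
            cm n p.1 (centralBond c) p.2) : GaugeField P n (SU N) × SU N) :=
        (hiter.comp measurable_fst).prodMk (measurable_cm_prod icb cm hcm n (centralBond c))
      have hset : {p : GaugeField P 0 (SU N) × SU N | p.2 ∈ cw (n + 1) p.1 c} =
          {p : GaugeField P 0 (SU N) × SU N | p.2 ∈ cw n p.1 (centralBond c)} ∩
            ⋂ i : Idx P, (fun p : GaugeField P 0 (SU N) × SU N =>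
              ((Averaging.iter (fun i => BlockAveraging.blockAvg (P := P) (j := i) (expMeanLogSU (n := Fin N))) n p.1,
                cm n p.1 (centralBond c) p.2) : GaugeField P n (SU N) × SU N)) ⁻¹'
              {q : GaugeField P n (SU N) × SU N | dist1 (fibreFamily q.1 c (pre q.1 c * q.2 * post q.1 c) i) ≤ α} := by
        ext p
        simp only [mem_setOf_eq, mem_inter_iff, mem_iInter, mem_preimage]
        rw [hcwS]
        simp only [mem_setOf_eq]
      rw [hset]
      exact (IH (centralBond c)).inter (MeasurableSet.iInter fun i => (measurableSet_le (measurable_coord_prod c i) measurable_const).preimage hpair)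

/-- The iterated window at a fixed environment is measurable. [folklore] -/
theorem measurableSet_cw {α : ℝ}
    (hcm : ∀ n U c g, cm n U c g =
      Averaging.iter (fun i => BlockAveraging.blockAvg (P := P) (j := i) (expMeanLogSU (n := Fin N))) n (update U (icb n c) g) c)
    (hcw0 : ∀ U c, cw 0 U c = univ)
    (hcwS : ∀ n U (c : PBond P (n + 1)), cw (n + 1) U c = {g | g ∈ cw n U (centralBond c) ∧
      cm n U (centralBond c) g ∈ {h : SU N | ∀ i : Idx P,
        dist1 (fibreFamily (Averaging.iter (fun i => BlockAveraging.blockAvg (P := P) (j := i) (expMeanLogSU (n := Fin N))) n U) c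
          (pre (Averaging.iter (fun i => BlockAveraging.blockAvg (P := P) (j := i) (expMeanLogSU (n := Fin N))) n U) c * h *
            post (Averaging.iter (fun i => BlockAveraging.blockAvg (P := P) (j := i) (expMeanLogSU (n := Fin N))) n U) c) i) ≤ α}})
    (n : ℕ) (U : GaugeField P 0 (SU N)) (c : PBond P n) : MeasurableSet (cw n U c) :=
  (measurableSet_cw_prod icb cm cw hcm hcw0 hcwS n c).preimage (measurable_const.prodMk measurable_id)

/-- ★★ **THE CHAIN IS INJECTIVE ON THE ITERATED WINDOW** (`n ≤ m + K`; `0 ≤ α ≤ 1∕24`, `64·α ≤ δ_N`, gap numerics): N09's one-step injectivity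
`avgFun_update_centralBond_injOn_centralWindow` composed through the chain recursion. [cite: Balaban1987RG1, (0.4) p.253 and p.267] -/
theorem injOn_cm {α : ℝ} (hα0 : 0 ≤ α) (hα24 : α ≤ 1 / 24) (hα64 : 64 * α ≤ deltaSU (Fin N))
    (hgap : ∀ j (c : PBond P (j + 1)), (offCard c : ℝ) / (Fintype.card (Idx P) : ℝ) + 150 * α < 1)
    (hicb0 : ∀ c, icb 0 c = c) (hicbS : ∀ n (c : PBond P (n + 1)), icb (n + 1) c = icb n (centralBond c))
    (hcm : ∀ n U c g, cm n U c g =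
      Averaging.iter (fun i => BlockAveraging.blockAvg (P := P) (j := i) (expMeanLogSU (n := Fin N))) n (update U (icb n c) g) c)
    (hcwS : ∀ n U (c : PBond P (n + 1)), cw (n + 1) U c = {g | g ∈ cw n U (centralBond c) ∧
      cm n U (centralBond c) g ∈ {h : SU N | ∀ i : Idx P,
        dist1 (fibreFamily (Averaging.iter (fun i => BlockAveraging.blockAvg (P := P) (j := i) (expMeanLogSU (n := Fin N))) n U) c
          (pre (Averaging.iter (fun i => BlockAveraging.blockAvg (P := P) (j := i) (expMeanLogSU (n := Fin N))) n U) c * h *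
            post (Averaging.iter (fun i => BlockAveraging.blockAvg (P := P) (j := i) (expMeanLogSU (n := Fin N))) n U) c) i) ≤ α}}) :
    ∀ {n : ℕ}, n ≤ P.m + P.K → ∀ (U : GaugeField P 0 (SU N)) (c : PBond P n), InjOn (cm n U c) (cw n U c) := by
  intro n
  induction n with
  | zero =>
      intro _ U c g₁ _ g₂ _ h
      rwa [cm_zero_apply _ icb hicb0 cm hcm, cm_zero_apply _ icb hicb0 cm hcm] at h
  | succ n IH =>
      intro hn U c g₁ hg₁ g₂ hg₂ h
      have hαδ : α < deltaSU (Fin N) := by nlinarith [ExpMeanLog.deltaSU_pos (n := Fin N)]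
      rw [hcwS] at hg₁ hg₂
      rw [cm_succ_apply _ icb hicb0 hicbS cm hcm hn, cm_succ_apply _ icb hicb0 hicbS cm hcm hn] at h
      have h1 := avgFun_update_centralBond_injOn_centralWindow (N := N) hn
        (Averaging.iter (fun i => BlockAveraging.blockAvg (P := P) (j := i) (expMeanLogSU (n := Fin N))) n U) c hα0 hα24 hαδ
        (hgap n c) hg₁.2 hg₂.2 h
      exact IH (by omega) U (centralBond c) hg₁.1 hg₂.1 h1

/-- ★★ **THE CHAIN IS CONTINUOUS ON THE ITERATED WINDOW, WHICH IS CLOSED** (`n ≤ m + K`; `α ≤ 1∕24`, `64·α ≤ δ_N`, `0 < α`, `157·α < L^{−(d−1)}`): N09's open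
mapping at window points gives continuity of each one-step map at every point of its closed window; the windows are preimages of closed sets under maps
continuous on closed sets. [cite: Balaban1987RG1, (0.4) p.253 and (2.9) p.266] -/
theorem continuousOn_cm_and_isClosed_cw {α : ℝ} (hα0 : 0 < α) (hα24 : α ≤ 1 / 24) (hα64 : 64 * α ≤ deltaSU (Fin N))
    (hαL : 157 * α < ((P.L : ℝ) ^ (P.d - 1))⁻¹)
    (hicb0 : ∀ c, icb 0 c = c) (hicbS : ∀ n (c : PBond P (n + 1)), icb (n + 1) c = icb n (centralBond c))
    (hcm : ∀ n U c g, cm n U c g =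
      Averaging.iter (fun i => BlockAveraging.blockAvg (P := P) (j := i) (expMeanLogSU (n := Fin N))) n (update U (icb n c) g) c)
    (hcw0 : ∀ U c, cw 0 U c = univ)
    (hcwS : ∀ n U (c : PBond P (n + 1)), cw (n + 1) U c = {g | g ∈ cw n U (centralBond c) ∧
      cm n U (centralBond c) g ∈ {h : SU N | ∀ i : Idx P,
        dist1 (fibreFamily (Averaging.iter (fun i => BlockAveraging.blockAvg (P := P) (j := i) (expMeanLogSU (n := Fin N))) n U) c
          (pre (Averaging.iter (fun i => BlockAveraging.blockAvg (P := P) (j := i) (expMeanLogSU (n := Fin N))) n U) c * h *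
            post (Averaging.iter (fun i => BlockAveraging.blockAvg (P := P) (j := i) (expMeanLogSU (n := Fin N))) n U) c) i) ≤ α}}) :
    ∀ {n : ℕ}, n ≤ P.m + P.K → ∀ (U : GaugeField P 0 (SU N)) (c : PBond P n),
      ContinuousOn (cm n U c) (cw n U c) ∧ IsClosed (cw n U c) := by
  intro n
  induction n with
  | zero =>
      intro _ U c
      refine ⟨?_, by rw [hcw0]; exact isClosed_univ⟩
      have hid : cm 0 U c = id := funext fun g => cm_zero_apply _ icb hicb0 cm hcm U c g
      rw [hid]; exact continuousOn_id
  | succ n IH =>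
      intro hn U c
      have hαδ : α < deltaSU (Fin N) := by nlinarith [ExpMeanLog.deltaSU_pos (n := Fin N)]
      obtain ⟨hcont, hclosed⟩ := IH (by omega) U (centralBond c)
      have hcwS' := hcwS n U c
      have hsucc' : ∀ g', cm (n + 1) U c g' = avgFun (expMeanLogSU (n := Fin N))
          (update (Averaging.iter (fun i => BlockAveraging.blockAvg (P := P) (j := i) (expMeanLogSU (n := Fin N))) n U) (centralBond c)
            (cm n U (centralBond c) g')) c := fun g' => cm_succ_apply _ icb hicb0 hicbS cm hcm hn U c g'
      generalize Averaging.iter (fun i => BlockAveraging.blockAvg (P := P) (j := i) (expMeanLogSU (n := Fin N))) n U = W at hcwS' hsucc'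
      have hsub : cw (n + 1) U c ⊆ cw n U (centralBond c) := fun g hg => by rw [hcwS'] at hg; exact hg.1
      have hwin : ∀ g ∈ cw (n + 1) U c, ∀ i : Idx P, dist1 (fibreFamily W c (pre W c * cm n U (centralBond c) g * post W c) i) ≤ α :=
        fun g hg => by rw [hcwS'] at hg; exact hg.2
      have hsucc : ∀ g', cm (n + 1) U c g' =
          (fun h : SU N => avgFun (expMeanLogSU (n := Fin N)) (update W (centralBond c) h) c) (cm n U (centralBond c) g') := hsucc'
      refine ⟨?_, ?_⟩
      · intro g hg
        have hf : ContinuousAt (fun h : SU N => avgFun (expMeanLogSU (n := Fin N)) (update W (centralBond c) h) c) (cm n U (centralBond c) g) :=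
          (map_nhds_oneVariable_eq_of_mem_centralWindow (N := N) hn W c hα24 hαδ hαL (hwin g hg)).le
        have heq : EqOn (cm (n + 1) U c) ((fun h : SU N => avgFun (expMeanLogSU (n := Fin N)) (update W (centralBond c) h) c) ∘ cm n U (centralBond c))
            (cw (n + 1) U c) := fun g' _ => hsucc g'
        refine ContinuousWithinAt.congr_of_eventuallyEq ?_ (eventually_nhdsWithin_of_forall heq) (heq hg)
        exact hf.comp_continuousWithinAt ((hcont g (hsub hg)).mono hsub)
      · have hset : cw (n + 1) U c = cw n U (centralBond c) ∩ cm n U (centralBond c) ⁻¹'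
            {h : SU N | ∀ i : Idx P, dist1 (fibreFamily W c (pre W c * h * post W c) i) ≤ α} := by
          ext g; rw [hcwS']; rfl
        rw [hset]
        refine hcont.preimage_isClosed_of_isClosed hclosed ?_
        exact (isClosed_centralWindowW W c α).preimage ((continuous_const.mul continuous_id).mul continuous_const)

/-- ★ **IMAGE-WINDOW RECURSION**: `cm (n+1) U c '' cw (n+1) U c = Ū′_{Ū⁽ⁿ⁾U, c} '' (cm n U (β c) '' cw n U (β c) ∩ Ω_α(Ū⁽ⁿ⁾U, c))`. [cite: Balaban1987RG1, (0.4) p.253] -/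
theorem image_cw_succ {α : ℝ}
    (hicb0 : ∀ c, icb 0 c = c) (hicbS : ∀ n (c : PBond P (n + 1)), icb (n + 1) c = icb n (centralBond c))
    (hcm : ∀ n U c g, cm n U c g =
      Averaging.iter (fun i => BlockAveraging.blockAvg (P := P) (j := i) (expMeanLogSU (n := Fin N))) n (update U (icb n c) g) c)
    (hcwS : ∀ n U (c : PBond P (n + 1)), cw (n + 1) U c = {g | g ∈ cw n U (centralBond c) ∧
      cm n U (centralBond c) g ∈ {h : SU N | ∀ i : Idx P,
        dist1 (fibreFamily (Averaging.iter (fun i => BlockAveraging.blockAvg (P := P) (j := i) (expMeanLogSU (n := Fin N))) n U) c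
          (pre (Averaging.iter (fun i => BlockAveraging.blockAvg (P := P) (j := i) (expMeanLogSU (n := Fin N))) n U) c * h *
            post (Averaging.iter (fun i => BlockAveraging.blockAvg (P := P) (j := i) (expMeanLogSU (n := Fin N))) n U) c) i) ≤ α}})
    {n : ℕ} (hn : n + 1 ≤ P.m + P.K) (U : GaugeField P 0 (SU N)) (c : PBond P (n + 1)) :
    cm (n + 1) U c '' cw (n + 1) U c =
      (fun h : SU N => avgFun (expMeanLogSU (n := Fin N))
        (update (Averaging.iter (fun i => BlockAveraging.blockAvg (P := P) (j := i) (expMeanLogSU (n := Fin N))) n U) (centralBond c) h) c) ''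
      (cm n U (centralBond c) '' cw n U (centralBond c) ∩
        {h : SU N | ∀ i : Idx P,
          dist1 (fibreFamily (Averaging.iter (fun i => BlockAveraging.blockAvg (P := P) (j := i) (expMeanLogSU (n := Fin N))) n U) c
            (pre (Averaging.iter (fun i => BlockAveraging.blockAvg (P := P) (j := i) (expMeanLogSU (n := Fin N))) n U) c * h *
              post (Averaging.iter (fun i => BlockAveraging.blockAvg (P := P) (j := i) (expMeanLogSU (n := Fin N))) n U) c) i) ≤ α}) := by
  have hset : cw (n + 1) U c = cw n U (centralBond c) ∩ cm n U (centralBond c) ⁻¹'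
      {h : SU N | ∀ i : Idx P,
        dist1 (fibreFamily (Averaging.iter (fun i => BlockAveraging.blockAvg (P := P) (j := i) (expMeanLogSU (n := Fin N))) n U) c
          (pre (Averaging.iter (fun i => BlockAveraging.blockAvg (P := P) (j := i) (expMeanLogSU (n := Fin N))) n U) c * h *
            post (Averaging.iter (fun i => BlockAveraging.blockAvg (P := P) (j := i) (expMeanLogSU (n := Fin N))) n U) c) i) ≤ α} := by
    ext g; rw [hcwS]; rfl
  have hcomp : ∀ g, cm (n + 1) U c g = (fun h : SU N => avgFun (expMeanLogSU (n := Fin N))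
      (update (Averaging.iter (fun i => BlockAveraging.blockAvg (P := P) (j := i) (expMeanLogSU (n := Fin N))) n U) (centralBond c) h) c)
      (cm n U (centralBond c) g) := fun g => cm_succ_apply _ icb hicb0 hicbS cm hcm hn U c g
  rw [hset, ← image_inter_preimage, ← image_comp]
  exact image_congr fun g _ => hcomp g

/-- ★★★ **THE IMAGE WINDOW OF THE CHAIN IS CLOSED AND HAS HAAR-NULL FRONTIER, FOR EVERY ENVIRONMENT** (`n ≤ m + K`; chart regime `0 < α ≤ 1∕24`,
`64·α ≤ δ_N`, `157·α < L^{−(d−1)}`, gap numerics): `T⁽ⁿ⁾ := cm n U c '' cw n U c` is closed and `Haar(T⁽ⁿ⁾ ∖ interior T⁽ⁿ⁾) = 0`.  Induction on the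
image-window recursion: `T⁽ⁿ⁺¹⁾ = f '' (T⁽ⁿ⁾ ∩ Ω)` is a continuous image of a compact set; a point `f w` with `w` interior to `T⁽ⁿ⁾` and STRICTLY inside
`Ω` is interior to `T⁽ⁿ⁺¹⁾` (N09: `f` is open at window points), so `T⁽ⁿ⁺¹⁾ ∖ int ⊆ f '' ((T⁽ⁿ⁾ ∖ int) ∩ Ω) ∪ f '' (Ω ∩ edge Ω)`, two images of Haar-null
measurable subsets of the window — Haar-null by part 1's PUSH. [cite: Balaban1987RG1, (0.4) p.253, (2.9) p.266 and (2.10) p.267] -/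
theorem isClosed_image_and_haar_diff_interior_eq_zero {α : ℝ} (hα0 : 0 < α) (hα24 : α ≤ 1 / 24) (hα64 : 64 * α ≤ deltaSU (Fin N))
    (hαL : 157 * α < ((P.L : ℝ) ^ (P.d - 1))⁻¹)
    (hgap : ∀ j (c : PBond P (j + 1)), (offCard c : ℝ) / (Fintype.card (Idx P) : ℝ) + 150 * α < 1)
    (hicb0 : ∀ c, icb 0 c = c) (hicbS : ∀ n (c : PBond P (n + 1)), icb (n + 1) c = icb n (centralBond c))
    (hcm : ∀ n U c g, cm n U c g =
      Averaging.iter (fun i => BlockAveraging.blockAvg (P := P) (j := i) (expMeanLogSU (n := Fin N))) n (update U (icb n c) g) c)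
    (hcw0 : ∀ U c, cw 0 U c = univ)
    (hcwS : ∀ n U (c : PBond P (n + 1)), cw (n + 1) U c = {g | g ∈ cw n U (centralBond c) ∧
      cm n U (centralBond c) g ∈ {h : SU N | ∀ i : Idx P,
        dist1 (fibreFamily (Averaging.iter (fun i => BlockAveraging.blockAvg (P := P) (j := i) (expMeanLogSU (n := Fin N))) n U) c
          (pre (Averaging.iter (fun i => BlockAveraging.blockAvg (P := P) (j := i) (expMeanLogSU (n := Fin N))) n U) c * h *
            post (Averaging.iter (fun i => BlockAveraging.blockAvg (P := P) (j := i) (expMeanLogSU (n := Fin N))) n U) c) i) ≤ α}}) :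
    ∀ {n : ℕ}, n ≤ P.m + P.K → ∀ (U : GaugeField P 0 (SU N)) (c : PBond P n),
      IsClosed (cm n U c '' cw n U c) ∧
        (HaarData.haar : Measure (SU N)) (cm n U c '' cw n U c \ interior (cm n U c '' cw n U c)) = 0 := by
  intro n
  induction n with
  | zero =>
      intro _ U c
      have hid : cm 0 U c = id := funext fun g => cm_zero_apply _ icb hicb0 cm hcm U c g
      rw [hid, hcw0, image_id, interior_univ]
      exact ⟨isClosed_univ, by simp⟩
  | succ n IH =>
      intro hn U c
      classical
      obtain ⟨hTclosed, hTnull⟩ := IH (by omega) U (centralBond c)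
      have hαδ : α < deltaSU (Fin N) := by nlinarith [ExpMeanLog.deltaSU_pos (n := Fin N)]
      rw [image_cw_succ icb cm cw hicb0 hicbS hcm hcwS hn U c]
      generalize Averaging.iter (fun i => BlockAveraging.blockAvg (P := P) (j := i) (expMeanLogSU (n := Fin N))) n U = W
      generalize cm n U (centralBond c) '' cw n U (centralBond c) = T at hTclosed hTnull
      -- letters at the environment `W`
      have hΩclosed : IsClosed {h : SU N | ∀ i : Idx P, dist1 (fibreFamily W c (pre W c * h * post W c) i) ≤ α} :=
        (isClosed_centralWindowW W c α).preimage ((continuous_const.mul continuous_id).mul continuous_const)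
      have hfat : ∀ w : SU N, (∀ i : Idx P, dist1 (fibreFamily W c (pre W c * w * post W c) i) ≤ α) →
          ContinuousAt (fun h : SU N => avgFun (expMeanLogSU (n := Fin N)) (update W (centralBond c) h) c) w :=
        fun w hw => (map_nhds_oneVariable_eq_of_mem_centralWindow (N := N) hn W c hα24 hαδ hαL hw).le
      have hfcont : ContinuousOn (fun h : SU N => avgFun (expMeanLogSU (n := Fin N)) (update W (centralBond c) h) c)
          (T ∩ {h : SU N | ∀ i : Idx P, dist1 (fibreFamily W c (pre W c * h * post W c) i) ≤ α}) :=
        fun w hw => (hfat w hw.2).continuousWithinAt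
      have hclosed : IsClosed ((fun h : SU N => avgFun (expMeanLogSU (n := Fin N)) (update W (centralBond c) h) c) ''
          (T ∩ {h : SU N | ∀ i : Idx P, dist1 (fibreFamily W c (pre W c * h * post W c) i) ≤ α})) :=
        ((hTclosed.inter hΩclosed).isCompact.image_of_continuousOn hfcont).isClosed
      refine ⟨hclosed, ?_⟩
      -- the frontier recursion: `T' ∖ int T' ⊆ f '' ((T ∖ int T) ∩ Ω) ∪ f '' (Ω ∩ edge Ω)`
      have hsub : (fun h : SU N => avgFun (expMeanLogSU (n := Fin N)) (update W (centralBond c) h) c) ''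
            (T ∩ {h : SU N | ∀ i : Idx P, dist1 (fibreFamily W c (pre W c * h * post W c) i) ≤ α}) \
          interior ((fun h : SU N => avgFun (expMeanLogSU (n := Fin N)) (update W (centralBond c) h) c) ''
            (T ∩ {h : SU N | ∀ i : Idx P, dist1 (fibreFamily W c (pre W c * h * post W c) i) ≤ α})) ⊆
          (fun h : SU N => avgFun (expMeanLogSU (n := Fin N)) (update W (centralBond c) h) c) ''
            ((T \ interior T) ∩ {h : SU N | ∀ i : Idx P, dist1 (fibreFamily W c (pre W c * h * post W c) i) ≤ α}) ∪
          (fun h : SU N => avgFun (expMeanLogSU (n := Fin N)) (update W (centralBond c) h) c) ''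
            ({h : SU N | ∀ i : Idx P, dist1 (fibreFamily W c (pre W c * h * post W c) i) ≤ α} ∩
              {h : SU N | ∃ i : Idx P, dist1 (fibreFamily W c (pre W c * h * post W c) i) = α}) := by
        rintro v ⟨⟨w, ⟨hwT, hwΩ⟩, rfl⟩, hvint⟩
        by_cases hwint : w ∈ interior T
        · by_cases hstrict : ∀ i : Idx P, dist1 (fibreFamily W c (pre W c * w * post W c) i) < α
          · exfalso
            apply hvint
            rw [mem_interior_iff_mem_nhds, ← map_nhds_oneVariable_eq_of_mem_centralWindow (N := N) hn W c hα24 hαδ hαL hwΩ]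
            refine Filter.image_mem_map (mem_of_superset ((isOpen_interior.inter (isOpen_strictCentralWindowSet W c α)).mem_nhds
              ⟨hwint, hstrict⟩) ?_)
            exact inter_subset_inter interior_subset fun h (hh : ∀ i : Idx P, dist1 (fibreFamily W c (pre W c * h * post W c) i) < α) i => (hh i).le
          · right
            refine ⟨w, ⟨hwΩ, ?_⟩, rfl⟩
            obtain ⟨i, hi⟩ := not_forall.1 hstrict
            exact ⟨i, le_antisymm (hwΩ i) (not_lt.1 hi)⟩
        · left
          exact ⟨w, ⟨⟨hwT, hwint⟩, hwΩ⟩, rfl⟩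
      refine measure_mono_null hsub (measure_union_null ?_ ?_)
      · exact haar_image_eq_zero_of_subset_window (N := N) hn hα0.le hα24 hα64 hαL (hgap n) W c
          ((hTclosed.measurableSet.diff isOpen_interior.measurableSet).inter hΩclosed.measurableSet) inter_subset_right
          (measure_mono_null inter_subset_left hTnull)
      · exact haar_image_eq_zero_of_subset_window (N := N) hn hα0.le hα24 hα64 hαL (hgap n) W c
          (hΩclosed.measurableSet.inter (measurableSet_edgeSet W c α)) inter_subset_left
          (measure_mono_null inter_subset_right (haar_edgeSet_eq_zero W c hα0.ne'))

end Chain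

end Summit.QuantumFields.YangMills.Theorems.FluctuationComparisonRegPrIntLWregChartChainLetters

end
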